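import Literature.RingTheory.Idempotents.AdicIdempotentLifting
import Literature.RingTheory.Idempotents.FiniteAlgebraLocalDecomposition
import Literature.RingTheory.Idempotents.FiniteAlgebraLocalFactorsRank
import Mathlib.RingTheory.Ideal.Quotient.Operations
import HarnessLib

/-!
# Route `RamifiedHeegnerPair`, crux U₁ `LeafRankOneUpperAtThree` (stmt-BirchSwinnertonDyer-26022), line `partnerdescent` —
# partner kernel: the LOCAL FACTOR `𝕋_𝔪` of a finite free algebra over a complete local ring (semi-local bookkeeping `ℤ₃ ⊗ 𝕋 = ∏ 𝕋_𝔪`)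

HONEST FRAMING. Theorems only; helper file (`--supports stmt-BirchSwinnertonDyer-26022 --as helper`); pure commutative algebra —
three tree theorems of `Literature/RingTheory/Idempotents` (Hodge cell capital: adic idempotent lifting, Stacks 04GG decomposition,
freeness of corners) glued into the one statement the (G3♭ˢ) assembly consumes; no number theory, no named fact, no `sorry`; nothing
booked; BSD is proved for no curve. Lead prover bsd-line-rhp-p2 g63, 2026-08-31.

WHY. The assembled (G3♭ˢ) theorem `LeafPartnerOrders.smul_sub_mem_annihilator_iff_forall_smul_mem`
(‹…LeafPartnerOrdersCongruenceLattice›, this gen) is LOCAL: it speaks of the Hecke algebra `𝕋_𝔪` at the non-Eisenstein maximal ideal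
`𝔪 = 𝔪_{f,3}`, a finite free `ℤ₃`-algebra that is a local ring, of `B_𝔪 = X_q(J_0(qrM))_𝔪` free of rank one over it, of units
`T_ℓ − ℓ − 1 ∈ 𝕋_𝔪^×`. The typed arithmetic inputs ((C3) multiplicity one, (C5) `δ ∣ η′`, the projector clauses) and the landed exact
Eisenstein property are GLOBAL statements about integer Brandt matrices. Between the two sits the «semi-local bookkeeping
`ℤ₃ ⊗ 𝕋 = ∏_𝔪 𝕋_𝔪`» that LEAD-G61/G62 listed as unwritten glue. Over `ℤ_(3)` it is FALSE in general (`𝕋_(3)` need not split: a congruence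
of `f` with a form `g` through ONE of two primes of `K_g` above `3` makes `(𝕋_(3))_𝔪` non-finite over `ℤ_(3)`), so the assembly must run
over the `3`-adic integers; there it is the henselian property. This file records it in the form needed:

* `exists_isIdempotentElem_mk_eq` — over a local ring `R` complete and separated for its maximal ideal (`IsAdicComplete`, e.g. `ℤ_[p]`),
  in a commutative `R`-algebra `A` finite free as an `R`-module, EVERY idempotent of `A ⧸ 𝔪_R A` lifts to an idempotent of `A`
  (tree: Newton iteration `e ↦ 3e² − 2e³`, `Literature.RingTheory.Idempotents.exists_isIdempotentElem_sub_mem_smul_top`).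
* `exists_isIdempotentElem_localFactor` — for every maximal ideal `𝔫` of such an `A` there is an idempotent `e` with `1 − e ∈ 𝔫`,
  `e ∈ 𝔫′` for every other maximal ideal `𝔫′`, whose corner `A ⧸ (1 − e)` (`≅ eA`) is a LOCAL ring and a FREE `R`-module
  (tree: `exists_completeOrthogonalIdempotents_isLocalRing_of_lift`, `free_quotient_span_one_sub`). This is `𝕋_𝔫 = e·(ℤ₃ ⊗ 𝕋)`.
* `isUnit_mk_span_of_not_mem` — an element of `A` outside `𝔫` becomes a UNIT in the corner at `𝔫` (used for `T_ℓ − ℓ − 1 ∉ 𝔪`: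
  the exact-Eisenstein operator is invertible on `B_𝔪`, hypothesis `hu` of `bijective_of_forall_exists_eq_comp`).
* `comap_maximalIdeal_eq` — the maximal ideal of the corner pulls back to `𝔫`.

[cite: StacksProject, Tag 04GG (Lemma 10.153.3–10.153.4)] [cite: Matsumura1987, Thm. 8.15 (finite algebras over complete local rings decompose)]
-/

set_option linter.dupNamespace false
set_option autoImplicit false

namespace Summit.BirchSwinnertonDyer.BirchSwinnertonDyer.Theorems.LeafPartnerOrders

open IsLocalRing Literature.RingTheory.Idempotents

variable {R : Type*} [CommRing R] [IsLocalRing R] [IsAdicComplete (maximalIdeal R) R]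
  {A : Type*} [CommRing A] [Algebra R A] [Module.Finite R A] [Module.Free R A]

/-- **Idempotents lift along `A → A ⧸ 𝔪_R A`** for a commutative algebra `A`, finite free over a local ring `R` that is complete and
separated for its maximal ideal (e.g. `R = ℤ_[p]`, `A = ℤ_[p] ⊗ 𝕋` for a Hecke algebra `𝕋`). Newton iteration in the coordinates of a
basis (tree theorem `exists_isIdempotentElem_sub_mem_smul_top`), with `𝔪_R • A = 𝔪_R A` (`Ideal.smul_top_eq_map`).
[cite: StacksProject, Tag 04GG (10.153.3 (characterisations of henselian pairs))] -/
theorem exists_isIdempotentElem_mk_eq (ē : A ⧸ (maximalIdeal R).map (algebraMap R A)) (hē : IsIdempotentElem ē) :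
    ∃ e : A, IsIdempotentElem e ∧ Ideal.Quotient.mk ((maximalIdeal R).map (algebraMap R A)) e = ē := by
  classical
  obtain ⟨e₀, rfl⟩ := Ideal.Quotient.mk_surjective ē
  have hmem : ∀ x : A, x ∈ (maximalIdeal R).map (algebraMap R A) ↔ x ∈ (maximalIdeal R) • (⊤ : Submodule R A) := by
    intro x
    rw [Ideal.smul_top_eq_map, Submodule.restrictScalars_mem]
  have he₀ : e₀ * e₀ - e₀ ∈ (maximalIdeal R) • (⊤ : Submodule R A) := by
    rw [← hmem, ← Ideal.Quotient.eq_zero_iff_mem, map_sub, map_mul]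
    exact sub_eq_zero.mpr hē
  obtain ⟨e, he, hee₀⟩ :=
    exists_isIdempotentElem_sub_mem_smul_top (maximalIdeal R) (Module.Free.chooseBasis R A) e₀ he₀
  refine ⟨e, he, ?_⟩
  rw [Ideal.Quotient.eq, hmem]
  exact hee₀

/-- **The local factor at a maximal ideal.** For every maximal ideal `𝔫` of `A` (finite free over the complete local `R`) there is an
idempotent `e ∈ A` with `1 − e ∈ 𝔫` and `e ∈ 𝔫′` for every maximal `𝔫′ ≠ 𝔫`, whose corner `A ⧸ (1 − e) ≅ eA` is a LOCAL ring and a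
FREE `R`-module: `A ≅ eA × (1 − e)A` with `eA = A_𝔫`. In the derivation `R = ℤ₃`, `A = ℤ₃ ⊗ 𝕋` (`𝕋` the Hecke algebra of the Brandt
module `X_q(J_0(qrM))`), `𝔫 = 𝔪_{f,3}`, `eA = 𝕋_𝔪`; the modules `B_𝔪 = eB̂`, `Y_𝔪 = eŶ` are the corresponding corners.
[cite: StacksProject, Tag 04GG (10.153.4)] [cite: Matsumura1987, Thm. 8.15] -/
theorem exists_isIdempotentElem_localFactor (𝔫 : Ideal A) [h𝔫 : 𝔫.IsMaximal] :
    ∃ e : A, IsIdempotentElem e ∧ 1 - e ∈ 𝔫 ∧ (∀ 𝔫' : Ideal A, 𝔫'.IsMaximal → 𝔫' ≠ 𝔫 → e ∈ 𝔫') ∧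
      IsLocalRing (A ⧸ Ideal.span {1 - e}) ∧ Module.Free R (A ⧸ Ideal.span {1 - e}) := by
  classical
  haveI := isArtinianRing_quotient (R := R) (A := A)
  letI : Fintype (MaximalSpectrum (A ⧸ (maximalIdeal R).map (algebraMap R A))) := Fintype.ofFinite _
  obtain ⟨e, he, hsep1, hsep0, hloc⟩ :=
    exists_completeOrthogonalIdempotents_isLocalRing_of_lift (R := R) (A := A)
      (fun ē hē ↦ exists_isIdempotentElem_mk_eq ē hē)
  -- the maximal ideal of `A ⧸ 𝔪_R A` under `𝔫`
  let I : MaximalSpectrum (A ⧸ (maximalIdeal R).map (algebraMap R A)) :=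
    ⟨𝔫.map (Ideal.Quotient.mk _), isMaximal_map_mk (R := R) 𝔫 h𝔫⟩
  have hI : I.asIdeal.comap (Ideal.Quotient.mk _) = 𝔫 := comap_map_mk (R := R) 𝔫 h𝔫
  refine ⟨e I, he.idem I, ?_, ?_, hloc I, free_quotient_span_one_sub (R := R) (he.idem I)⟩
  · have h := hsep1 I
    rwa [hI] at h
  · intro 𝔫' h𝔫' hne
    let I' : MaximalSpectrum (A ⧸ (maximalIdeal R).map (algebraMap R A)) :=
      ⟨𝔫'.map (Ideal.Quotient.mk _), isMaximal_map_mk (R := R) 𝔫' h𝔫'⟩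
    have hI' : I'.asIdeal.comap (Ideal.Quotient.mk _) = 𝔫' := comap_map_mk (R := R) 𝔫' h𝔫'
    have hII' : I ≠ I' := by
      intro h
      apply hne
      rw [← hI, ← hI', h]
    have h := hsep0 I I' hII'
    rwa [hI'] at h

omit [IsLocalRing R] [IsAdicComplete (maximalIdeal R) R] [Module.Finite R A] [Module.Free R A] in
/-- **The maximal ideal of the corner pulls back to `𝔫`.** If `e ∈ A` lies in every maximal ideal `𝔫′ ≠ 𝔫` and the corner
`A ⧸ (1 − e)` is local, then the preimage of its maximal ideal is `𝔫` (that preimage is a maximal ideal containing `1 − e`, so it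
cannot contain `e`, so it is `𝔫`). [cite: StacksProject, Tag 04GG (10.153.4)] -/
theorem comap_maximalIdeal_eq (𝔫 : Ideal A) {e : A}
    (hsep : ∀ 𝔫' : Ideal A, 𝔫'.IsMaximal → 𝔫' ≠ 𝔫 → e ∈ 𝔫') [IsLocalRing (A ⧸ Ideal.span {1 - e})] :
    (maximalIdeal (A ⧸ Ideal.span {1 - e})).comap (Ideal.Quotient.mk (Ideal.span {1 - e})) = 𝔫 := by
  have hsurj : Function.Surjective (Ideal.Quotient.mk (Ideal.span {1 - e})) := Ideal.Quotient.mk_surjective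
  haveI hM : ((maximalIdeal (A ⧸ Ideal.span {1 - e})).comap (Ideal.Quotient.mk (Ideal.span {1 - e}))).IsMaximal :=
    Ideal.comap_isMaximal_of_surjective _ hsurj
  by_contra hne
  have he : e ∈ (maximalIdeal (A ⧸ Ideal.span {1 - e})).comap (Ideal.Quotient.mk (Ideal.span {1 - e})) := hsep _ hM hne
  have h1e : 1 - e ∈ (maximalIdeal (A ⧸ Ideal.span {1 - e})).comap (Ideal.Quotient.mk (Ideal.span {1 - e})) := by
    rw [Ideal.mem_comap, Ideal.Quotient.eq_zero_iff_mem.mpr (Ideal.mem_span_singleton_self (1 - e))]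
    exact Ideal.zero_mem _
  have h1 : (1 : A) ∈ (maximalIdeal (A ⧸ Ideal.span {1 - e})).comap (Ideal.Quotient.mk (Ideal.span {1 - e})) := by
    have := Ideal.add_mem _ h1e he
    rwa [sub_add_cancel] at this
  exact hM.ne_top ((Ideal.eq_top_iff_one _).mpr h1)

omit [IsLocalRing R] [IsAdicComplete (maximalIdeal R) R] [Module.Finite R A] [Module.Free R A] in
/-- **Off `𝔫`, elements become units in the corner at `𝔫`.** With `e` as in `exists_isIdempotentElem_localFactor` (in every
maximal `𝔫′ ≠ 𝔫`, corner local), every `t ∉ 𝔫` maps to a UNIT of the local ring `A ⧸ (1 − e)`. In the derivation: `t = T_ℓ − ℓ − 1 ∉ 𝔪` (a prime `ℓ ∤ 3N` with `a_ℓ(f) ≢ ℓ + 1 (3)`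
exists since `ρ̄_{V,3}` is irreducible, tree theorem `exists_prime_not_dvd_lFunction_sub_of_hasIrreducibleModPGaloisRep`), so the
exact-Eisenstein operator is invertible on `B_𝔪` — hypothesis `hu` of `bijective_of_forall_exists_eq_comp`.
[cite: StacksProject, Tag 04GG (10.153.4)] -/
theorem isUnit_mk_span_of_not_mem (𝔫 : Ideal A) {e : A}
    (hsep : ∀ 𝔫' : Ideal A, 𝔫'.IsMaximal → 𝔫' ≠ 𝔫 → e ∈ 𝔫') [IsLocalRing (A ⧸ Ideal.span {1 - e})]
    {t : A} (ht : t ∉ 𝔫) : IsUnit (Ideal.Quotient.mk (Ideal.span {1 - e}) t) := by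
  by_contra hu
  have hmem : Ideal.Quotient.mk (Ideal.span {1 - e}) t ∈ maximalIdeal (A ⧸ Ideal.span {1 - e}) :=
    (IsLocalRing.mem_maximalIdeal _).mpr hu
  apply ht
  rw [← comap_maximalIdeal_eq 𝔫 hsep, Ideal.mem_comap]
  exact hmem

end Summit.BirchSwinnertonDyer.BirchSwinnertonDyer.Theorems.LeafPartnerOrders
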